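import Mathlib.Analysis.Calculus.ParametricIntervalIntegral
import Mathlib.Analysis.Calculus.ContDiff.FiniteDimension
import Literature.Analysis.Calculus.JointSmoothnessPartials
import Literature.Analysis.FluidPDE.NSVorticityOfSmoothRepresentative
import Literature.Analysis.FluidPDE.CarlemanRegularityC12
import HarnessLib

/-!
# The vorticity of a spatially smooth Navier–Stokes solution is of the class `C¹ ∩ {∂ₓω ∈ C¹}`

(draft part A: calculus)
-/

noncomputable section

open MeasureTheory Set Function Filter Metric intervalIntegral
open _root_.Topology
open scoped InnerProductSpace RealInnerProductSpace Interval Laplacian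

namespace Literature.Analysis.FluidPDE

section SliceCalculus

variable {E : Type*} [NormedAddCommGroup E] [NormedSpace ℝ E] [FiniteDimensional ℝ E]
variable {F : Type*} [NormedAddCommGroup F] [NormedSpace ℝ F] [CompleteSpace F]

/-- **Time derivative of the spatial derivative.** Let `I ⊆ ℝ`, `S ⊆ E` be open and
`ω, g : ℝ → E → F` with `∂ₜω(t, x) = g(t, x)` at every point of `I × S` (classical derivative in
`t`), every slice `ω(t, ·)` and `g(t, ·)` differentiable on `S`, and `g`, `(t, x) ↦ D(g(t,·))(x)`
jointly continuous on `I × S`. Then for `(t₀, x₀) ∈ I × S` the operator-valued map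
`t ↦ D(ω(t, ·))(x₀)` has derivative `D(g(t₀, ·))(x₀)` at `t₀`
(`ω(t) = ω(t₀) + ∫_{t₀}^t g(s) ds` near `x₀`, differentiation under the integral sign, and the
fundamental theorem of calculus). [folklore] -/
theorem hasDerivAt_fderiv_slice {I : Set ℝ} {S : Set E} (hI : IsOpen I) (hS : IsOpen S)
    {ω g : ℝ → E → F}
    (hω : ∀ t ∈ I, ∀ x ∈ S, HasDerivAt (fun s => ω s x) (g t x) t)
    (hωd : ∀ t ∈ I, DifferentiableOn ℝ (ω t) S)
    (hg0 : ContinuousOn (uncurry g) (I ×ˢ S))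
    (hgd : ∀ t ∈ I, DifferentiableOn ℝ (g t) S)
    (hg1 : ContinuousOn (fun p : ℝ × E => fderiv ℝ (g p.1) p.2) (I ×ˢ S))
    {t₀ : ℝ} (ht₀ : t₀ ∈ I) {x₀ : E} (hx₀ : x₀ ∈ S) :
    HasDerivAt (fun s => fderiv ℝ (ω s) x₀) (fderiv ℝ (g t₀) x₀) t₀ := by
  -- ## room: `[t₀ - δ, t₀ + δ] ⊆ I`, `closedBall x₀ ε ⊆ S`, and a bound for `D g` there
  obtain ⟨δ, hδ, hδI⟩ : ∃ δ > 0, Icc (t₀ - δ) (t₀ + δ) ⊆ I := by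
    obtain ⟨r, hr, hrI⟩ := Metric.isOpen_iff.1 hI t₀ ht₀
    refine ⟨r / 2, by positivity, fun s hs => hrI ?_⟩
    rw [mem_ball, Real.dist_eq, abs_lt]
    constructor <;> linarith [hs.1, hs.2]
  obtain ⟨ε, hε, hεS⟩ : ∃ ε > 0, closedBall x₀ ε ⊆ S := by
    obtain ⟨r, hr, hrS⟩ := Metric.isOpen_iff.1 hS x₀ hx₀
    exact ⟨r / 2, by positivity, (closedBall_subset_ball (by linarith)).trans hrS⟩
  set K : Set (ℝ × E) := Icc (t₀ - δ) (t₀ + δ) ×ˢ closedBall x₀ ε with hK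
  have hKc : IsCompact K := isCompact_Icc.prod (isCompact_closedBall _ _)
  have hKO : K ⊆ I ×ˢ S := prod_mono hδI hεS
  obtain ⟨B, hB⟩ := hKc.exists_bound_of_continuousOn (hg1.mono hKO)
  set J : Set ℝ := Ioo (t₀ - δ) (t₀ + δ) with hJdef
  have hJ : J ⊆ I := Ioo_subset_Icc_self.trans hδI
  have hJo : IsOpen J := isOpen_Ioo
  have ht₀J : t₀ ∈ J := ⟨by linarith, by linarith⟩
  have ht₀c : t₀ ∈ Icc (t₀ - δ) (t₀ + δ) := ⟨by linarith, by linarith⟩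
  have huIcc : ∀ t ∈ J, uIcc t₀ t ⊆ Icc (t₀ - δ) (t₀ + δ) := fun t ht =>
    uIcc_subset_Icc ht₀c (Ioo_subset_Icc_self ht)
  have huIoc : ∀ t ∈ J, Ι t₀ t ⊆ Icc (t₀ - δ) (t₀ + δ) := fun t ht =>
    uIoc_subset_uIcc.trans (huIcc t ht)
  -- slices in `t` of the continuous data
  have hgx : ∀ x ∈ S, ContinuousOn (fun s => g s x) I := fun x hx =>
    hg0.comp (continuous_id.prodMk continuous_const).continuousOn fun s hs => ⟨hs, hx⟩
  have hg1x : ContinuousOn (fun s => fderiv ℝ (g s) x₀) I :=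
    hg1.comp (continuous_id.prodMk continuous_const).continuousOn fun s hs => ⟨hs, hx₀⟩
  -- ## (1) the integral representation `ω t x = ω t₀ x + ∫_{t₀}^t g s x ds` on `S`
  have hint : ∀ x ∈ S, ∀ t ∈ J, IntervalIntegrable (fun s => g s x) volume t₀ t :=
    fun x hx t ht => ((hgx x hx).mono ((huIcc t ht).trans hδI)).intervalIntegrable
  have hrep : ∀ t ∈ J, ∀ x ∈ S, ω t x = ω t₀ x + ∫ s in t₀..t, g s x := by
    intro t ht x hx
    have h := integral_eq_sub_of_hasDerivAt (f := fun s => ω s x) (f' := fun s => g s x)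
      (a := t₀) (b := t) (fun s hs => hω s (hδI (huIcc t ht hs)) x hx) (hint x hx t ht)
    rw [h]; abel
  -- ## (2) differentiation under the integral sign at `x₀`
  have hpar : ∀ t ∈ J,
      HasFDerivAt (fun x => ∫ s in t₀..t, g s x) (∫ s in t₀..t, fderiv ℝ (g s) x₀) x₀ := by
    intro t ht
    have hsI : ∀ s ∈ Ι t₀ t, s ∈ I := fun s hs => hδI (huIoc t ht hs)
    refine intervalIntegral.hasFDerivAt_integral_of_dominated_of_fderiv_le
      (μ := volume) (𝕜 := ℝ) (F := fun x s => g s x) (F' := fun x s => fderiv ℝ (g s) x)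
      (a := t₀) (b := t) (bound := fun _ => B) (ball_mem_nhds x₀ hε) ?_ (hint x₀ hx₀ t ht)
      ?_ ?_ intervalIntegrable_const ?_
    · filter_upwards [ball_mem_nhds x₀ hε] with x hx
      exact ((hgx x (hεS (ball_subset_closedBall hx))).mono hsI).aestronglyMeasurable
        measurableSet_uIoc
    · exact (hg1x.mono hsI).aestronglyMeasurable measurableSet_uIoc
    · exact Eventually.of_forall fun s hs x hx => hB (s, x) ⟨huIoc t ht hs, ball_subset_closedBall hx⟩
    · refine Eventually.of_forall fun s hs x hx => ?_
      exact ((hgd s (hsI s hs)).differentiableAt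
        (hS.mem_nhds (hεS (ball_subset_closedBall hx)))).hasFDerivAt
  -- ## (3) `D(ω t)(x₀) = D(ω t₀)(x₀) + ∫_{t₀}^t D(g s)(x₀) ds` for `t ∈ J`
  have hformula : ∀ t ∈ J,
      fderiv ℝ (ω t) x₀ = fderiv ℝ (ω t₀) x₀ + ∫ s in t₀..t, fderiv ℝ (g s) x₀ := by
    intro t ht
    have hev : ω t =ᶠ[𝓝 x₀] fun x => ω t₀ x + ∫ s in t₀..t, g s x := by
      filter_upwards [hS.mem_nhds hx₀] with x hx
      exact hrep t ht x hx
    rw [hev.fderiv_eq]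
    have hd₀ : DifferentiableAt ℝ (ω t₀) x₀ := (hωd t₀ ht₀).differentiableAt (hS.mem_nhds hx₀)
    rw [fderiv_fun_add hd₀ (hpar t ht).differentiableAt, (hpar t ht).fderiv]
  -- ## (4) the fundamental theorem of calculus at `t₀`
  have hftc : HasDerivAt (fun t => ∫ s in t₀..t, fderiv ℝ (g s) x₀) (fderiv ℝ (g t₀) x₀) t₀ :=
    integral_hasDerivAt_right IntervalIntegrable.refl
      ((hg1x.mono hJ).stronglyMeasurableAtFilter hJo _ ht₀J)
      ((hg1x.mono hJ).continuousAt (hJo.mem_nhds ht₀J))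
  have h := hftc.const_add (fderiv ℝ (ω t₀) x₀)
  refine h.congr_of_eventuallyEq ?_
  filter_upwards [hJo.mem_nhds ht₀J] with t ht
  exact hformula t ht

/-- **Joint `C¹` regularity of the spatial derivative from the vorticity-type structure.** Under
the hypotheses of `hasDerivAt_fderiv_slice`, if moreover every slice `ω(t, ·)` is `C²` on `S`
and `(t, x) ↦ D²(ω(t,·))(x)` (as `D(D ω(t,·))`) is jointly continuous on `I × S`, then the
operator field `(t, x) ↦ D(ω(t, ·))(x)` is jointly `C¹` on `I × S` (continuous partial
derivatives: `D(g(t,·))(x)` in `t` by `hasDerivAt_fderiv_slice`, `D²(ω(t,·))(x)` in `x`;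
`Calculus.contDiffOn_succ_of_partial`). [folklore] -/
theorem contDiffOn_one_fderiv_slice {I : Set ℝ} {S : Set E} (hI : IsOpen I) (hS : IsOpen S)
    {ω g : ℝ → E → F}
    (hω : ∀ t ∈ I, ∀ x ∈ S, HasDerivAt (fun s => ω s x) (g t x) t)
    (hω2 : ∀ t ∈ I, ContDiffOn ℝ 2 (ω t) S)
    (hω2c : ContinuousOn (fun p : ℝ × E => fderiv ℝ (fun y => fderiv ℝ (ω p.1) y) p.2) (I ×ˢ S))
    (hg0 : ContinuousOn (uncurry g) (I ×ˢ S))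
    (hgd : ∀ t ∈ I, DifferentiableOn ℝ (g t) S)
    (hg1 : ContinuousOn (fun p : ℝ × E => fderiv ℝ (g p.1) p.2) (I ×ˢ S)) :
    ContDiffOn ℝ 1 (fun p : ℝ × E => fderiv ℝ (ω p.1) p.2) (I ×ˢ S) := by
  have hO : IsOpen (I ×ˢ S) := hI.prod hS
  have hωd : ∀ t ∈ I, DifferentiableOn ℝ (ω t) S := fun t ht =>
    (hω2 t ht).differentiableOn (by norm_num)
  -- the two partial-derivative fields
  set f₁ : ℝ × E → ℝ →L[ℝ] (E →L[ℝ] F) := fun p =>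
    (1 : ℝ →L[ℝ] ℝ).smulRight (fderiv ℝ (g p.1) p.2) with hf₁
  set f₂ : ℝ × E → E →L[ℝ] (E →L[ℝ] F) := fun p =>
    fderiv ℝ (fun y => fderiv ℝ (ω p.1) y) p.2 with hf₂
  have h₁ : ∀ p ∈ I ×ˢ S, HasFDerivAt (fun a : ℝ => fderiv ℝ (ω a) p.2) (f₁ p) p.1 :=
    fun p hp => (hasDerivAt_fderiv_slice hI hS hω hωd hg0 hgd hg1 hp.1 hp.2).hasFDerivAt
  have h₂ : ∀ p ∈ I ×ˢ S, HasFDerivAt (fun b : E => fderiv ℝ (ω p.1) b) (f₂ p) p.2 := by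
    intro p hp
    have hc : ContDiffOn ℝ 1 (fderiv ℝ (ω p.1)) S := (hω2 p.1 hp.1).fderiv_of_isOpen hS le_rfl
    exact ((hc.differentiableOn one_ne_zero).differentiableAt (hS.mem_nhds hp.2)).hasFDerivAt
  have hc₁ : ContDiffOn ℝ 0 f₁ (I ×ˢ S) := by
    rw [contDiffOn_zero]
    exact (ContinuousLinearMap.smulRightL ℝ ℝ (E →L[ℝ] F) (1 : ℝ →L[ℝ] ℝ)).continuous.comp_continuousOn hg1
  have hc₂ : ContDiffOn ℝ 0 f₂ (I ×ˢ S) := contDiffOn_zero.2 hω2c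
  exact Calculus.contDiffOn_succ_of_partial (f := fun p : ℝ × E => fderiv ℝ (ω p.1) p.2) (n := 0)
    hO h₁ h₂ hc₁ hc₂

end SliceCalculus

section SliceCalculusInner

variable {E : Type*} [NormedAddCommGroup E] [InnerProductSpace ℝ E] [FiniteDimensional ℝ E]
variable {F : Type*} [NormedAddCommGroup F] [InnerProductSpace ℝ F] [CompleteSpace F]

/-- **The frame derivatives `∂ₑ(uncurry ω)` are jointly `C¹`** under the hypotheses of
`contDiffOn_one_fderiv_slice` (on the open set, `∂ₑ(uncurry ω)(t, x) = D(ω(t,·))(x) e`). [folklore] -/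
theorem contDiffOn_one_dx_uncurry_of_slice {I : Set ℝ} {S : Set E} (hI : IsOpen I) (hS : IsOpen S)
    {ω g : ℝ → E → F}
    (hω : ∀ t ∈ I, ∀ x ∈ S, HasDerivAt (fun s => ω s x) (g t x) t)
    (hω1 : ContDiffOn ℝ 1 (uncurry ω) (I ×ˢ S))
    (hω2 : ∀ t ∈ I, ContDiffOn ℝ 2 (ω t) S)
    (hω2c : ContinuousOn (fun p : ℝ × E => fderiv ℝ (fun y => fderiv ℝ (ω p.1) y) p.2) (I ×ˢ S))
    (hg0 : ContinuousOn (uncurry g) (I ×ˢ S))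
    (hgd : ∀ t ∈ I, DifferentiableOn ℝ (g t) S)
    (hg1 : ContinuousOn (fun p : ℝ × E => fderiv ℝ (g p.1) p.2) (I ×ˢ S)) (e : E) :
    ContDiffOn ℝ 1 (Carleman.dx e (uncurry ω)) (I ×ˢ S) := by
  have hO : IsOpen (I ×ˢ S) := hI.prod hS
  have hD := contDiffOn_one_fderiv_slice hI hS hω hω2 hω2c hg0 hgd hg1
  have h : ContDiffOn ℝ 1 (fun p : ℝ × E => fderiv ℝ (ω p.1) p.2 e) (I ×ˢ S) :=
    hD.clm_apply contDiffOn_const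
  refine h.congr fun p hp => ?_
  have hd : DifferentiableAt ℝ (uncurry ω) (p.1, p.2) :=
    (hω1.differentiableOn one_ne_zero).differentiableAt (hO.mem_nhds hp)
  rw [show p = (p.1, p.2) from rfl]
  exact Carleman.dx_uncurry hd e

end SliceCalculusInner

section VorticityC12


set_option maxHeartbeats 800000 in
/-- **The vorticity of a spatially smooth distributional Navier–Stokes solution is of the class
`C¹ ∩ {∂ₓω ∈ C¹}`.** Let `(U, p)` solve the Navier–Stokes system (viscosity `1`, no force) in
the sense of distributions on `I × S` (`I`, `S` open), every slice `U(t, ·)` being `C⁴` on `S`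
and the spatial derivatives `(t, x) ↦ D_xⁿU(t, x)`, `n ≤ 4`, jointly continuous on `I × S`. Then
(i)–(iv) of `vorticity_classical_of_isDistributionalNSSolutionOn` hold (`div U = 0`, joint
continuity, the classical vorticity equation `∂ₜω = Δω - (U·∇)ω + (ω·∇)U`, `ω ∈ C¹` jointly),
and moreover (v) every frame derivative `∂ₑω` (`Carleman.dx e (uncurry ω)`) is jointly `C¹` on
`I × S`: the time derivative of `D_xω` is `D_x` of the (jointly continuous, spatially `C¹`)
right-hand side (`hasDerivAt_fderiv_slice`), and the partial derivatives are continuous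
(`contDiffOn_one_dx_uncurry_of_slice`). This is the regularity class of the Carleman estimates
`Carleman.backwardUniqueness_uncurried_c12`, `Carleman.uniqueContinuation_uncurried_c12`
(ESS 2003, §3: the vorticity of the blow-up limit, which is `C¹` but not `C²` in time). [folklore] -/
theorem vorticity_c12_of_isDistributionalNSSolutionOn {I : Set ℝ} {S : Set (EuclideanSpace ℝ (Fin 3))}
    (hI : IsOpen I) (hS : IsOpen S) {U : ℝ → (EuclideanSpace ℝ (Fin 3)) → (EuclideanSpace ℝ (Fin 3))} {p : ℝ → (EuclideanSpace ℝ (Fin 3)) → ℝ}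
    (hsol : IsDistributionalNSSolutionOn ⟨I ×ˢ S, hI.prod hS⟩ 1 0 U p)
    (hU4 : ∀ t ∈ I, ContDiffOn ℝ 4 (U t) S)
    (hΦ : ∀ n ≤ 4, ContinuousOn (fun w : ℝ × (EuclideanSpace ℝ (Fin 3)) => iteratedFDeriv ℝ n (U w.1) w.2) (I ×ˢ S)) :
    (∀ w ∈ I ×ˢ S, VectorCalculus.divergence (U w.1) w.2 = 0) ∧
    ContinuousOn (uncurry U) (I ×ˢ S) ∧
    (∀ t ∈ I, ∀ x ∈ S, HasDerivAt (fun s => vorticity U s x)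
      ((1 : ℝ) • Δ (vorticity U t) x - convect (U t) (vorticity U t) x +
        convect (vorticity U t) (U t) x) t) ∧
    ContDiffOn ℝ 1 (uncurry (vorticity U)) (I ×ˢ S) ∧
    ∀ e : (EuclideanSpace ℝ (Fin 3)), ContDiffOn ℝ 1 (Carleman.dx e (uncurry (vorticity U))) (I ×ˢ S) := by
  set O : Set (ℝ × (EuclideanSpace ℝ (Fin 3))) := I ×ˢ S with hOdef
  have hO : IsOpen O := hI.prod hS
  obtain ⟨hdiv, hU0, hderiv, -, hω1⟩ := vorticity_classical_of_isDistributionalNSSolutionOn hI hS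
    hsol (fun t ht => (hU4 t ht).of_le (by norm_cast)) (fun n hn => hΦ n (by omega))
  refine ⟨hdiv, hU0, hderiv, hω1, ?_⟩
  -- ### joint continuity of the spatial derivatives of `U` and `ω`
  have hDU : ContinuousOn (fun w : ℝ × (EuclideanSpace ℝ (Fin 3)) => fderiv ℝ (U w.1) w.2) O :=
    continuousOn_fderiv_of_continuousOn_iteratedFDeriv_one (hΦ 1 (by norm_num))
  have hGn : ∀ n ≤ 3, ContinuousOn
      (fun w : ℝ × (EuclideanSpace ℝ (Fin 3)) => iteratedFDeriv ℝ n (fun y => fderiv ℝ (U w.1) y) w.2) O := fun n hn =>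
    continuousOn_iteratedFDeriv_fderiv_of_succ (hΦ (n + 1) (by omega))
  have hGd : ∀ n : ℕ, n ≤ 3 → ∀ w ∈ O, ContDiffAt ℝ n (fun y => fderiv ℝ (U w.1) y) w.2 := by
    intro n hn w hw
    have h4 : ContDiffAt ℝ 4 (U w.1) w.2 := (hU4 w.1 hw.1).contDiffAt (hS.mem_nhds hw.2)
    have h3 : ContDiffAt ℝ 3 (fderiv ℝ (U w.1)) w.2 := h4.fderiv_right (by norm_cast)
    exact h3.of_le (by exact_mod_cast hn)
  have hvort : vorticity U = fun t y => curlCLM (fderiv ℝ (U t) y) := by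
    funext t y; rfl
  have hωn : ∀ n ≤ 3,
      ContinuousOn (fun w : ℝ × (EuclideanSpace ℝ (Fin 3)) => iteratedFDeriv ℝ n (vorticity U w.1) w.2) O := by
    intro n hn
    have h := continuousOn_iteratedFDeriv_clm_comp (O := O) (H := fun t y => fderiv ℝ (U t) y)
      curlCLM (hGn n hn) (hGd n hn)
    rw [hvort]
    exact h
  have hω0 : ContinuousOn (uncurry (vorticity U)) O :=
    continuousOn_uncurry_of_continuousOn_iteratedFDeriv_zero (hωn 0 (by norm_num))
  have hDω : ContinuousOn (fun w : ℝ × (EuclideanSpace ℝ (Fin 3)) => fderiv ℝ (vorticity U w.1) w.2) O :=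
    continuousOn_fderiv_of_continuousOn_iteratedFDeriv_one (hωn 1 (by norm_num))
  have hω2c : ContinuousOn
      (fun w : ℝ × (EuclideanSpace ℝ (Fin 3)) => fderiv ℝ (fun y => fderiv ℝ (vorticity U w.1) y) w.2) O :=
    continuousOn_fderiv_of_continuousOn_iteratedFDeriv_one (H := fun t y => fderiv ℝ (vorticity U t) y)
      (continuousOn_iteratedFDeriv_fderiv_of_succ (hωn 2 (by norm_num)))
  have hU2c : ContinuousOn
      (fun w : ℝ × (EuclideanSpace ℝ (Fin 3)) => fderiv ℝ (fun y => fderiv ℝ (U w.1) y) w.2) O :=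
    continuousOn_fderiv_of_continuousOn_iteratedFDeriv_one (H := fun t y => fderiv ℝ (U t) y)
      (continuousOn_iteratedFDeriv_fderiv_of_succ (hΦ 2 (by norm_num)))
  have hD3ω := hωn 3 le_rfl
  -- ### slice regularity
  have hω3 : ∀ t ∈ I, ContDiffOn ℝ 3 (vorticity U t) S := by
    intro t ht
    rw [vorticity_apply, curl_eq_curlCLM_comp]
    exact curlCLM.contDiff.comp_contDiffOn ((hU4 t ht).fderiv_of_isOpen hS (by norm_cast))
  have hω2 : ∀ t ∈ I, ContDiffOn ℝ 2 (vorticity U t) S := fun t ht =>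
    (hω3 t ht).of_le (by norm_cast)
  -- ### the right-hand side `g` and its spatial derivative `G`
  set ω : ℝ → (EuclideanSpace ℝ (Fin 3)) → (EuclideanSpace ℝ (Fin 3)) := vorticity U with hωdef
  set g : ℝ → (EuclideanSpace ℝ (Fin 3)) → (EuclideanSpace ℝ (Fin 3)) := fun t x =>
    (1 : ℝ) • Δ (ω t) x - convect (U t) (ω t) x + convect (ω t) (U t) x with hgdef
  have hgc : ContinuousOn (uncurry g) O := by
    have hΔω : ContinuousOn (fun w : ℝ × (EuclideanSpace ℝ (Fin 3)) => Δ (ω w.1) w.2) O :=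
      continuousOn_laplacian_of_continuousOn_iteratedFDeriv_two (hωn 2 (by norm_num))
    have e : uncurry g = fun w : ℝ × (EuclideanSpace ℝ (Fin 3)) => (1 : ℝ) • Δ (ω w.1) w.2 -
        fderiv ℝ (ω w.1) w.2 (U w.1 w.2) + fderiv ℝ (U w.1) w.2 (ω w.1 w.2) := by
      funext w; rfl
    rw [e]
    exact ((hΔω.const_smul (1 : ℝ)).sub (hDω.clm_apply hU0)).add (hDU.clm_apply hω0)
  -- the basis and the three pieces of the derivative
  set b := EuclideanSpace.basisFun (Fin 3) ℝ with hb
  set cL := continuousMultilinearCurryLeftEquiv ℝ (fun _ : Fin 3 => (EuclideanSpace ℝ (Fin 3))) (EuclideanSpace ℝ (Fin 3)) with hcL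
  set D₁ : ℝ → (EuclideanSpace ℝ (Fin 3)) → ((EuclideanSpace ℝ (Fin 3)) →L[ℝ] (EuclideanSpace ℝ (Fin 3))) := fun t x =>
    ∑ i, (ContinuousMultilinearMap.apply ℝ (fun _ : Fin 2 => (EuclideanSpace ℝ (Fin 3))) (EuclideanSpace ℝ (Fin 3)) ![b i, b i]).comp
      ((cL (iteratedFDeriv ℝ 3 (ω t) x) : (EuclideanSpace ℝ (Fin 3)) →L[ℝ] ((EuclideanSpace ℝ (Fin 3)) [×2]→L[ℝ] (EuclideanSpace ℝ (Fin 3))))) with hD₁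
  set D₂ : ℝ → (EuclideanSpace ℝ (Fin 3)) → ((EuclideanSpace ℝ (Fin 3)) →L[ℝ] (EuclideanSpace ℝ (Fin 3))) := fun t x =>
    (fderiv ℝ (ω t) x).comp (fderiv ℝ (U t) x) +
      (fderiv ℝ (fun y => fderiv ℝ (ω t) y) x).flip (U t x) with hD₂
  set D₃ : ℝ → (EuclideanSpace ℝ (Fin 3)) → ((EuclideanSpace ℝ (Fin 3)) →L[ℝ] (EuclideanSpace ℝ (Fin 3))) := fun t x =>
    (fderiv ℝ (U t) x).comp (fderiv ℝ (ω t) x) +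
      (fderiv ℝ (fun y => fderiv ℝ (U t) y) x).flip (ω t x) with hD₃
  set G : ℝ × (EuclideanSpace ℝ (Fin 3)) → ((EuclideanSpace ℝ (Fin 3)) →L[ℝ] (EuclideanSpace ℝ (Fin 3))) := fun w =>
    (1 : ℝ) • D₁ w.1 w.2 - D₂ w.1 w.2 + D₃ w.1 w.2 with hG
  -- (T1) the Laplacian
  have hT1 : ∀ t ∈ I, ∀ x ∈ S, HasFDerivAt (fun y => Δ (ω t) y) (D₁ t x) x := by
    intro t ht x hx
    have h3 : ContDiffAt ℝ 3 (ω t) x := (hω3 t ht).contDiffAt (hS.mem_nhds hx)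
    have hd2 : DifferentiableAt ℝ (iteratedFDeriv ℝ 2 (ω t)) x :=
      h3.differentiableAt_iteratedFDeriv (by norm_cast)
    have hfd : fderiv ℝ (iteratedFDeriv ℝ 2 (ω t)) x = cL (iteratedFDeriv ℝ 3 (ω t) x) := by
      rw [fderiv_iteratedFDeriv]; rfl
    have hpiece : ∀ i : Fin 3, HasFDerivAt (fun y => iteratedFDeriv ℝ 2 (ω t) y ![b i, b i])
        ((ContinuousMultilinearMap.apply ℝ (fun _ : Fin 2 => (EuclideanSpace ℝ (Fin 3))) (EuclideanSpace ℝ (Fin 3)) ![b i, b i]).comp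
          (cL (iteratedFDeriv ℝ 3 (ω t) x) : (EuclideanSpace ℝ (Fin 3)) →L[ℝ] ((EuclideanSpace ℝ (Fin 3)) [×2]→L[ℝ] (EuclideanSpace ℝ (Fin 3))))) x := by
      intro i
      have h := (ContinuousMultilinearMap.apply ℝ (fun _ : Fin 2 => (EuclideanSpace ℝ (Fin 3))) (EuclideanSpace ℝ (Fin 3)) ![b i, b i]).hasFDerivAt.comp x
        hd2.hasFDerivAt
      rw [hfd] at h
      exact h
    have e : (fun y => Δ (ω t) y) = fun y => ∑ i, iteratedFDeriv ℝ 2 (ω t) y ![b i, b i] := by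
      funext y
      rw [InnerProductSpace.laplacian_eq_iteratedFDeriv_orthonormalBasis (ω t) b]
    rw [e, hD₁]
    exact HasFDerivAt.fun_sum fun i _ => hpiece i
  -- (T2), (T3) the transport terms
  have hT2 : ∀ t ∈ I, ∀ x ∈ S, HasFDerivAt (fun y => convect (U t) (ω t) y) (D₂ t x) x := by
    intro t ht x hx
    have hc : HasFDerivAt (fderiv ℝ (ω t)) (fderiv ℝ (fun y => fderiv ℝ (ω t) y) x) x := by
      have h1 : ContDiffOn ℝ 1 (fderiv ℝ (ω t)) S := (hω2 t ht).fderiv_of_isOpen hS le_rfl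
      exact ((h1.differentiableOn one_ne_zero).differentiableAt (hS.mem_nhds hx)).hasFDerivAt
    have hu : HasFDerivAt (U t) (fderiv ℝ (U t) x) x :=
      (((hU4 t ht).differentiableOn (by norm_num)).differentiableAt (hS.mem_nhds hx)).hasFDerivAt
    have h := hc.clm_apply hu
    simpa only [convect_apply] using h
  have hT3 : ∀ t ∈ I, ∀ x ∈ S, HasFDerivAt (fun y => convect (ω t) (U t) y) (D₃ t x) x := by
    intro t ht x hx
    have hc : HasFDerivAt (fderiv ℝ (U t)) (fderiv ℝ (fun y => fderiv ℝ (U t) y) x) x := by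
      have h1 : ContDiffOn ℝ 1 (fderiv ℝ (U t)) S := (hU4 t ht).fderiv_of_isOpen hS (by norm_cast)
      exact ((h1.differentiableOn one_ne_zero).differentiableAt (hS.mem_nhds hx)).hasFDerivAt
    have hu : HasFDerivAt (ω t) (fderiv ℝ (ω t) x) x :=
      (((hω2 t ht).differentiableOn (by norm_num)).differentiableAt (hS.mem_nhds hx)).hasFDerivAt
    have h := hc.clm_apply hu
    simpa only [convect_apply] using h
  have hgD : ∀ t ∈ I, ∀ x ∈ S, HasFDerivAt (g t) (G (t, x)) x := by
    intro t ht x hx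
    have h := (((hT1 t ht x hx).const_smul (1 : ℝ)).sub (hT2 t ht x hx)).add (hT3 t ht x hx)
    exact h
  have hgd : ∀ t ∈ I, DifferentiableOn ℝ (g t) S := fun t ht x hx =>
    (hgD t ht x hx).differentiableAt.differentiableWithinAt
  -- continuity of `G`
  have hGc : ContinuousOn G O := by
    have hD₁c : ContinuousOn (fun w : ℝ × (EuclideanSpace ℝ (Fin 3)) => D₁ w.1 w.2) O := by
      simp only [hD₁]
      refine continuousOn_finsetSum _ fun i _ => ?_
      refine ContinuousOn.clm_comp continuousOn_const ?_
      exact (cL : ((EuclideanSpace ℝ (Fin 3)) [×3]→L[ℝ] (EuclideanSpace ℝ (Fin 3))) ≃ₗᵢ[ℝ] ((EuclideanSpace ℝ (Fin 3)) →L[ℝ] ((EuclideanSpace ℝ (Fin 3)) [×2]→L[ℝ] (EuclideanSpace ℝ (Fin 3))))).continuous.comp_continuousOn hD3ω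
    have hD₂c : ContinuousOn (fun w : ℝ × (EuclideanSpace ℝ (Fin 3)) => D₂ w.1 w.2) O := by
      simp only [hD₂]
      refine (hDω.clm_comp hDU).add ?_
      have hflip : ContinuousOn (fun w : ℝ × (EuclideanSpace ℝ (Fin 3)) => (fderiv ℝ (fun y => fderiv ℝ (ω w.1) y) w.2).flip) O :=
        (ContinuousLinearMap.flipₗᵢ ℝ (EuclideanSpace ℝ (Fin 3)) (EuclideanSpace ℝ (Fin 3)) (EuclideanSpace ℝ (Fin 3))).continuous.comp_continuousOn hω2c
      exact hflip.clm_apply hU0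
    have hD₃c : ContinuousOn (fun w : ℝ × (EuclideanSpace ℝ (Fin 3)) => D₃ w.1 w.2) O := by
      simp only [hD₃]
      refine (hDU.clm_comp hDω).add ?_
      have hflip : ContinuousOn (fun w : ℝ × (EuclideanSpace ℝ (Fin 3)) => (fderiv ℝ (fun y => fderiv ℝ (U w.1) y) w.2).flip) O :=
        (ContinuousLinearMap.flipₗᵢ ℝ (EuclideanSpace ℝ (Fin 3)) (EuclideanSpace ℝ (Fin 3)) (EuclideanSpace ℝ (Fin 3))).continuous.comp_continuousOn hU2c
      exact hflip.clm_apply hω0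
    simp only [hG]
    exact ((hD₁c.const_smul (1 : ℝ)).sub hD₂c).add hD₃c
  have hg1 : ContinuousOn (fun w : ℝ × (EuclideanSpace ℝ (Fin 3)) => fderiv ℝ (g w.1) w.2) O :=
    hGc.congr fun w hw => (hgD w.1 hw.1 w.2 hw.2).fderiv
  -- ### conclusion
  intro e
  exact contDiffOn_one_dx_uncurry_of_slice hI hS hderiv hω1 hω2 hω2c hgc hgd hg1 e

/-- **The vorticity equation in the frame-operator form of the Carleman estimates.** In the
setting of `vorticity_c12_of_isDistributionalNSSolutionOn`, write `ω̃ = uncurry (vorticity U)`.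
Then on `I × S`: `Carleman.dt ω̃ (t, x) = Δω(t,x) - (U·∇)ω(t,x) + (ω·∇)U(t,x)`,
`Carleman.lap ω̃ (t, x) = Δ(ω(t, ·))(x)`, and, if `|U| ≤ K₀` and `‖D_xU‖ ≤ K₁` there,
`|∂ₜω̃ - Δω̃| ≤ (K₀ + K₁)(|ω̃| + |∇ω̃|)` pointwise (ESS 2003, (3.31): the vorticity of the
blow-up limit satisfies the differential inequality of Thms. 4.1/5.1 with
`c₁ = ‖U‖_∞ + ‖∇U‖_∞`). [cite: EscauriazaSereginSverak2003, §3 (3.31)] -/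
theorem vorticity_carleman_inequality {I : Set ℝ} {S : Set (EuclideanSpace ℝ (Fin 3))}
    (hI : IsOpen I) (hS : IsOpen S) {U : ℝ → (EuclideanSpace ℝ (Fin 3)) → (EuclideanSpace ℝ (Fin 3))} {p : ℝ → (EuclideanSpace ℝ (Fin 3)) → ℝ}
    (hsol : IsDistributionalNSSolutionOn ⟨I ×ˢ S, hI.prod hS⟩ 1 0 U p)
    (hU4 : ∀ t ∈ I, ContDiffOn ℝ 4 (U t) S)
    (hΦ : ∀ n ≤ 4, ContinuousOn (fun w : ℝ × (EuclideanSpace ℝ (Fin 3)) => iteratedFDeriv ℝ n (U w.1) w.2) (I ×ˢ S))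
    {K₀ K₁ : ℝ} (hK₀ : ∀ w ∈ I ×ˢ S, ‖U w.1 w.2‖ ≤ K₀)
    (hK₁ : ∀ w ∈ I ×ˢ S, ‖fderiv ℝ (U w.1) w.2‖ ≤ K₁) :
    (∀ z ∈ I ×ˢ S, Carleman.dt (uncurry (vorticity U)) z =
      (1 : ℝ) • Δ (vorticity U z.1) z.2 - convect (U z.1) (vorticity U z.1) z.2 +
        convect (vorticity U z.1) (U z.1) z.2) ∧
    (∀ z ∈ I ×ˢ S, Carleman.lap (uncurry (vorticity U)) z = Δ (vorticity U z.1) z.2) ∧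
    ∀ z ∈ I ×ˢ S, ‖Carleman.dt (uncurry (vorticity U)) z - Carleman.lap (uncurry (vorticity U)) z‖ ≤
      (K₀ + K₁) * (‖uncurry (vorticity U) z‖ +
        Real.sqrt (Carleman.gradSq (uncurry (vorticity U)) z)) := by
  have hO : IsOpen (I ×ˢ S) := hI.prod hS
  obtain ⟨-, -, hderiv, hω1, hωx⟩ := vorticity_c12_of_isDistributionalNSSolutionOn hI hS hsol hU4 hΦ
  have hd : ∀ z ∈ I ×ˢ S, DifferentiableAt ℝ (uncurry (vorticity U)) (z.1, z.2) := fun z hz =>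
    (hω1.differentiableOn one_ne_zero).differentiableAt (hO.mem_nhds hz)
  have hdt : ∀ z ∈ I ×ˢ S, Carleman.dt (uncurry (vorticity U)) z =
      (1 : ℝ) • Δ (vorticity U z.1) z.2 - convect (U z.1) (vorticity U z.1) z.2 +
        convect (vorticity U z.1) (U z.1) z.2 := by
    intro z hz
    rw [show z = (z.1, z.2) from rfl, Carleman.dt_uncurry (hd z hz), FluidPDE.timeDeriv_apply]
    exact (hderiv z.1 hz.1 z.2 hz.2).deriv
  have hlap : ∀ z ∈ I ×ˢ S, Carleman.lap (uncurry (vorticity U)) z = Δ (vorticity U z.1) z.2 := by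
    intro z hz
    rw [show z = (z.1, z.2) from rfl]
    exact Carleman.lap_eq_laplacian_slice_c12 (g := uncurry (vorticity U)) hO hω1 hωx hz
  refine ⟨hdt, hlap, fun z hz => ?_⟩
  have hK₀0 : 0 ≤ K₀ := (norm_nonneg _).trans (hK₀ z hz)
  have hK₁0 : 0 ≤ K₁ := (norm_nonneg _).trans (hK₁ z hz)
  rw [hdt z hz, hlap z hz]
  have e : (1 : ℝ) • Δ (vorticity U z.1) z.2 - convect (U z.1) (vorticity U z.1) z.2 +
      convect (vorticity U z.1) (U z.1) z.2 - Δ (vorticity U z.1) z.2 =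
      -(fderiv ℝ (vorticity U z.1) z.2 (U z.1 z.2)) + fderiv ℝ (U z.1) z.2 (vorticity U z.1 z.2) := by
    simp only [convect_apply, one_smul]
    abel
  rw [e]
  have hop : ‖fderiv ℝ (vorticity U z.1) z.2‖ ≤
      Real.sqrt (Carleman.gradSq (uncurry (vorticity U)) z) := by
    have h := Carleman.opNorm_fderiv_le_sqrt_gradSq (u := vorticity U) (hd z hz)
    rw [show ((z.1, z.2) : ℝ × (EuclideanSpace ℝ (Fin 3))) = z from rfl] at h
    exact h
  have hωz : ‖vorticity U z.1 z.2‖ = ‖uncurry (vorticity U) z‖ := rfl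
  calc ‖-(fderiv ℝ (vorticity U z.1) z.2 (U z.1 z.2)) + fderiv ℝ (U z.1) z.2 (vorticity U z.1 z.2)‖
      ≤ ‖fderiv ℝ (vorticity U z.1) z.2 (U z.1 z.2)‖ + ‖fderiv ℝ (U z.1) z.2 (vorticity U z.1 z.2)‖ := by
        refine (norm_add_le _ _).trans ?_
        rw [norm_neg]
    _ ≤ ‖fderiv ℝ (vorticity U z.1) z.2‖ * ‖U z.1 z.2‖ + ‖fderiv ℝ (U z.1) z.2‖ * ‖vorticity U z.1 z.2‖ :=
        add_le_add (ContinuousLinearMap.le_opNorm _ _) (ContinuousLinearMap.le_opNorm _ _)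
    _ ≤ Real.sqrt (Carleman.gradSq (uncurry (vorticity U)) z) * K₀ + K₁ * ‖uncurry (vorticity U) z‖ := by
        rw [hωz]
        exact add_le_add (mul_le_mul hop (hK₀ z hz) (norm_nonneg _) (Real.sqrt_nonneg _))
          (mul_le_mul_of_nonneg_right (hK₁ z hz) (norm_nonneg _))
    _ ≤ (K₀ + K₁) * (‖uncurry (vorticity U) z‖ + Real.sqrt (Carleman.gradSq (uncurry (vorticity U)) z)) := by
        have h1 : 0 ≤ Real.sqrt (Carleman.gradSq (uncurry (vorticity U)) z) := Real.sqrt_nonneg _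
        have h2 : 0 ≤ ‖uncurry (vorticity U) z‖ := norm_nonneg _
        nlinarith

end VorticityC12

end Literature.Analysis.FluidPDE
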